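import Literature.AnabelianGeometry.AbsoluteAnabelian.AbsTopII.BelyiCuspidalizationChainU
import Literature.AnabelianGeometry.AbsoluteAnabelian.AbsTopII.BelyiCuspidalizationContentPointPreserving
import HarnessLib

/-!
# [AbsTopII] Cor 3.7 with the content of (a), v2 (`BelyiModel.Cor_3_7''`): the NON-VACUOUS instance
# form — point-preserving NF-opens realize the identity chain (port of p434918 to the `U`-slot typing)

S. Mochizuki, *Topics in Absolute Anabelian Geometry II: Decomposition Groups and Endomorphisms*
[AbsTopII] (bib key `MochizukiAbsTopII2013`; manuscript pagination, lit key `paper:url-585b8d0ad0d9`):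
Example 3.6 pp. 71–72, Corollary 3.7 pp. 72–73; [AbsTopI] (`MochizukiAbsTopI2012`) Def 4.2 (iii)
pp. 49–50.

PROOF-ONLY companion (no definition, no instance, no structure) of abc-iut-L4-t6's
`AbsTopII/BelyiCuspidalizationChainU.lean` (`BelyiCuspidalization.RealizesChain'`, `BelyiModel.Cor_3_7''`
— v2 of the F-f064-1 repair: `U`-slot at `s + m = t`, `W`-slot at `w + n = s`; finding F-f067g2-1,
abc-iut-L4-lead RULING #7s), cell abc-iut, seat abc-iut-f-064.  PORT of
`BelyiCuspidalizationContentPointPreserving.lean` (p434918, the same instance form for v1): the identity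
chain witness there has chain parameters `(l, n, m) = (0, 0, 0)`, hence `n = 0`, and for `n = 0` the
v1 and v2 predicates coincide (`W = U`; abc-iut-L4-t6's `RealizesChain.realizesChain'_of_n_eq_zero`,
`BelyiCuspidalizationChainUProofs.lean`) — the repackaging `w := s` is inlined here so that this file
depends on the statements file only.  Sibling of `BelyiCuspidalizationChainUSchemaScope.lean`
(separation model; kernel form; with NO cusp recorded `Cor_3_7''` forces every NF-open to be
point-preserving).  PROVED:

* `BelyiModel.realizesChain'_of_cuspOf_injective` — a point-preserving NF-open (`Π_{U_X} ↠ Π`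
  injective) of a member satisfying the standing hypotheses v2-REALIZES the identity chain
  `Π ⇝ Π ⇝ Π ⇝ Π ⇝ Π` of type `⋏, ⋎, ⋏, ⋎` with `w = s = t = 3` (EMPTY `W ⇝ U` and `U ⇝ V` blocks),
  the output being "`Π_V := Π`, `Π_U := Π_{U_X}`, chain parameters `(0, 0, 0)`" with cuspidalization the
  model's own `Π_{U_X} ↠ Π`;
* `BelyiModel.cor_3_7''_of_cuspOf_injective` — hence a model all of whose NF-opens are point-preserving
  satisfies `Cor_3_7''`; TIGHT against the sibling's `Cor_3_7''.cuspOf_injective_of_isEmpty_cusp`.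

READING (honest framing): statements about OUR typed interface `(𝒟, M)`; a point-preserving "NF-open"
is the degenerate datum `U_X = X`.  Nothing in print is touched; typed ≠ proved; no side taken on
[IUTchIII] Cor 3.12.
-/

open CategoryTheory Topology
open scoped Pointwise

universe u

namespace Literature.AnabelianGeometry.AbsoluteAnabelian.AbsTopII

open Literature.AlgebraicGeometry.Frobenioids (IsSlimGroup)
open FundamentalExtension
open AbsTopI (ConstructionDataClass)

variable {𝒟 : ConstructionDataClass.{u}}

namespace BelyiModel

variable (M : BelyiModel 𝒟)

/-- **A point-preserving NF-open v2-realizes the identity chain.**  For a member `X` satisfying the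
standing hypotheses of Cor 3.7 and an NF-open `U_X` with `Π_{U_X} ↠ Π` INJECTIVE there is an output
of the Cor-3.7 shape with `Π_V := Π`, chain parameters `(0, 0, 0)`, cuspidalization the model's own
`Π_{U_X} ↠ Π` (same images of cuspidal decomposition groups), which realizes in the v2 sense
(`RealizesChain'`: `W`-slot `w`, `U`-slot `s`, `V`-slot `t`, here `w = s = t = 3`) the identity chain
`Π ⇝ Π ⇝ Π ⇝ Π ⇝ Π` of type `⋏, ⋎, ⋏, ⋎` — the v1 witness of p434918 re-read with `w := s` (for
`n = 0` the two predicates coincide, `W = U`). [cite: MochizukiAbsTopII2013, Cor 3.7 pp.72-73] -/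
theorem realizesChain'_of_cuspOf_injective {b : 𝒟.Base} {X : (𝒟.datum b).Obj}
    (h : M.IsCor37Member b X) (U : M.NFOpen b X)
    (hinj : Function.Injective (M.cuspOf U).hom.arith) :
    ∃ B : BelyiCuspidalization ((𝒟.datum b).ext X),
      B.cusp = M.cuspOf U ∧ B.PiV = ⊤ ∧ B.chainParams = (0, 0, 0) ∧
        B.cusp.decompositionImages B.cusps = (M.cuspOf U).decompositionImages (M.cuspsOf U) ∧
        B.RealizesChain' (M.cusps b X) h.arith_slim h.geom_slim h.geom_ne_bot := by
  obtain ⟨B, hB, hV, hpar, himg, hreal⟩ := M.realizesChain_of_cuspOf_injective h U hinj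
  obtain ⟨c, htype, hiso, s, t, hst, ht, eU, eV, gU, gV, ψ, hU, hVV, hψs, hsteps, hψt⟩ := hreal
  have hn : B.chainParams.2.1 = 0 := by rw [hpar]
  refine ⟨B, hB, hV, hpar, himg, c, htype, hiso, s, s, t, by omega, by omega, ht, eU, eV, gU, gV, ψ,
    hU, hVV, hψs, hsteps, hψt⟩

/-- **NON-VACUOUS instance form of the v2-repaired Cor 3.7**: a model all of whose NF-opens (on
members satisfying the standing hypotheses) remove NO point — every `Π_{U_X} ↠ Π` injective,
"`U_X = X`" — satisfies `BelyiModel.Cor_3_7''` (the hypotheses "`𝒟` chain-full, rel-isom-DGC" are not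
used).  TIGHT against the sibling certificate `Cor_3_7''.cuspOf_injective_of_isEmpty_cusp`
(`BelyiCuspidalizationChainUSchemaScope.lean`): at a member with no recorded cusp these are the ONLY
NF-opens for which `Cor_3_7''` can hold. [cite: MochizukiAbsTopII2013, Cor 3.7 pp.72-73] -/
theorem cor_3_7''_of_cuspOf_injective
    (hinj : ∀ (b : 𝒟.Base) (X : (𝒟.datum b).Obj), M.IsCor37Member b X → ∀ U : M.NFOpen b X,
      Function.Injective (M.cuspOf U).hom.arith) : M.Cor_3_7'' := by
  intro _ _ b X h U
  obtain ⟨B, hB, -, -, himg, hreal⟩ := M.realizesChain'_of_cuspOf_injective h U (hinj b X h U)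
  refine ⟨B, ?_, himg, hreal⟩
  rw [hB]
  exact Cuspidalization.IsoOver.refl _

end BelyiModel

end Literature.AnabelianGeometry.AbsoluteAnabelian.AbsTopII
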